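import Summits.RiemannHypothesis.RiemannHypothesis.Theorems.SemilocalNegCertNineteenKinked1573
import HarnessLib

/-!
# Semi-local threshold of the `{∞,2,…,19}` form, negative side: `a*({2,…,19}) ≤ 1611/1024` — the wall `q = 23` from a KINKED (piecewise-cubic) witness (part 6/17: the kernel facts piece 60 … piece 71 of 173 (imports part 1 only))

Cell `rh-explicit` (HOME `run/shared/lean/pub/rh-explicit/`), seat cc-s2-9 gen0 (HUMAN RULING D-0074 (D5) WEIL data engine; LADDER-RH column WEIL, rung DATA → W-P(P2);
pipeline = cc-s2-4 gen8/gen11's piecewise-witness layer `SemilocalPiecewise{Witness,Increment,IncrementSum,Cert}.lean` + their float finder, every number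
re-derived by an independent second engine E2 before filing).  HONEST FRAMING: RH-FREE theorems about the tree's `weilSemilocalThreshold S` of a
TRUNCATED Weil form (finitely many places); nothing here bears on the truth of RH; the lower clause `(log q)/2 ≤ a*(S_q)` at all primes IS RH and is untouched.

Third kinked row of this seat (after the walls q = 17, 19: `SemilocalNegCertThirteenKinked1423*`, `SemilocalNegCertSeventeenKinked1478*`).  WHY KINKED (cc-s2-4 `KNEE-NOTE`):
at `b ≈ a*(S_23) + 0.005` the polynomial × indicator class is still flat (tree row `203/128` at degree 13, `SemilocalNegCertNineteen`, `δ*(23) ≤ 0.0182`), whereas an odd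
piecewise cubic with slope breaks at ALL TWELVE atom images `|b − log n|` (`n ≤ 19` an `S`-smooth prime power, rounded to `/1024`) is negative by `3.45·10⁻³‖G‖²`.
Instance: `S = {2,3,5,7,11,13,17,19}`, `b = 1611/1024 = 1.5732421875`, `N = 23` (atom table `atomsNineteen` / `atomsEnclose_Nineteen` of `SemilocalNegCertNineteen.lean`),
13 pieces of degree ≤ 3; TWO ENGINES on the witness before the kernel: cc-s2-4's float finder `λ_min = −3.4514·10⁻³` (kit j249756) and this seat's exact-in-`x` decimal
engine E2 `R = −3.4549·10⁻³` (no polar credit); exact kernel margin `(rhs − lhs)/‖G‖² = 3.449e-03` (farm report, 173 `t`-pieces).  ⇒ **`a*({2,…,19}) ≤ 1611/1024`, `δ*(23) ≤ 0.0055`** (was `0.0182`);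
DATA (cc-s2-6, certified walls): `a*(S_23) = 1.567925`, `δ*(23) ≈ 1.8·10⁻⁴`.  No data is trusted: every bound is a `decide +kernel` fact of `SemilocalPiecewiseCert.lean`.  Folklore throughout.
-/

set_option autoImplicit false
set_option linter.dupNamespace false  -- the mandated namespace repeats `RiemannHypothesis`
set_option Elab.async false  -- serialise the kernel facts: in parallel they exhaust the node's per-process heap (cc-s2-4 gen11, CC4-LEAN §16.10)

noncomputable section

open Complex Filter Set MeasureTheory Topology
open scoped Real

namespace Summit.RiemannHypothesis.RiemannHypothesis.Theorems.SemilocalPolyWitness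

open MeasureTheory Set Finset Real
open Literature.NumberTheory.LFunctions
open Summit.RiemannHypothesis.RiemannHypothesis.Theorems.MotivicDoor
open Summit.RiemannHypothesis.RiemannHypothesis.Theorems.MotivicDoor.SemilocalThreshold
open Summit.RiemannHypothesis.RiemannHypothesis.Theorems.MotivicDoor.SemilocalMarkov
open LQ

set_option maxHeartbeats 0 in
/-- kernel fact: piece `60` of `certNineteenKinked1573`. -/
theorem check_NineteenKinked1573_piece60 : certNineteenKinked1573.checkPiecePW 60 = true := by
  decide +kernel

set_option maxHeartbeats 0 in
/-- kernel fact: piece `61` of `certNineteenKinked1573`. -/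
theorem check_NineteenKinked1573_piece61 : certNineteenKinked1573.checkPiecePW 61 = true := by
  decide +kernel

set_option maxHeartbeats 0 in
/-- kernel fact: piece `62` of `certNineteenKinked1573`. -/
theorem check_NineteenKinked1573_piece62 : certNineteenKinked1573.checkPiecePW 62 = true := by
  decide +kernel

set_option maxHeartbeats 0 in
/-- kernel fact: piece `63` of `certNineteenKinked1573`. -/
theorem check_NineteenKinked1573_piece63 : certNineteenKinked1573.checkPiecePW 63 = true := by
  decide +kernel

set_option maxHeartbeats 0 in
/-- kernel fact: piece `64` of `certNineteenKinked1573`. -/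
theorem check_NineteenKinked1573_piece64 : certNineteenKinked1573.checkPiecePW 64 = true := by
  decide +kernel

set_option maxHeartbeats 0 in
/-- kernel fact: piece `65` of `certNineteenKinked1573`. -/
theorem check_NineteenKinked1573_piece65 : certNineteenKinked1573.checkPiecePW 65 = true := by
  decide +kernel

set_option maxHeartbeats 0 in
/-- kernel fact: piece `66` of `certNineteenKinked1573`. -/
theorem check_NineteenKinked1573_piece66 : certNineteenKinked1573.checkPiecePW 66 = true := by
  decide +kernel

set_option maxHeartbeats 0 in
/-- kernel fact: piece `67` of `certNineteenKinked1573`. -/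
theorem check_NineteenKinked1573_piece67 : certNineteenKinked1573.checkPiecePW 67 = true := by
  decide +kernel

set_option maxHeartbeats 0 in
/-- kernel fact: piece `68` of `certNineteenKinked1573`. -/
theorem check_NineteenKinked1573_piece68 : certNineteenKinked1573.checkPiecePW 68 = true := by
  decide +kernel

set_option maxHeartbeats 0 in
/-- kernel fact: piece `69` of `certNineteenKinked1573`. -/
theorem check_NineteenKinked1573_piece69 : certNineteenKinked1573.checkPiecePW 69 = true := by
  decide +kernel

set_option maxHeartbeats 0 in
/-- kernel fact: piece `70` of `certNineteenKinked1573`. -/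
theorem check_NineteenKinked1573_piece70 : certNineteenKinked1573.checkPiecePW 70 = true := by
  decide +kernel

set_option maxHeartbeats 0 in
/-- kernel fact: piece `71` of `certNineteenKinked1573`. -/
theorem check_NineteenKinked1573_piece71 : certNineteenKinked1573.checkPiecePW 71 = true := by
  decide +kernel

end Summit.RiemannHypothesis.RiemannHypothesis.Theorems.SemilocalPolyWitness

end
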